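import Summits.CriticalPhenomena.SAWScalingLimit.Theorems.LeftRightFKG.Negative.PAKitMain
import Summits.CriticalPhenomena.SAWScalingLimit.Theorems.LeftRightFKG.Negative.InstancePA
import Summits.CriticalPhenomena.SAWScalingLimit.Theorems.LeftRightFKG.Negative.BoxDomain
import Summits.CriticalPhenomena.SAWScalingLimit.Theorems.LeftRightFKG.Negative.RectMesh
import Summits.CriticalPhenomena.SAWScalingLimit.Theorems.LeftRightFKG.Negative.CornerCertXc
import HarnessLib

/-!
# Negative knowledge on crux `LeftRightFKG`, part 19: FULL left–right positive association of the `5 × 4` crux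
instance AT `x_c`, certified (`PAKit`, parts 13–17; computational grade)

Crux `stmt-CriticalPhenomena-11232` (`Summit.CriticalPhenomena.SAWScalingLimit.Theses.SAWLeftRightFKG.LeftRightFKG`).
The instance of part 3 (`BoxDomain`): `δ = 1`, `C = Cwalk` = boundary walk of `[-1,5] × [-1,4]`, `Ω = dom Cwalk 1`
(= `Ωb`, lattice sites `{0..4} × {0..3}`), `a = (0,0)`, `b = (4,3)`, `a' = (0,-1)`, `b' = (4,4)`; 976 chords of
length `≤ 19`.

* `dAdj54_iff`, `isInstance54`, `length_le54` — the box plumbing (`Rect.dAdj_iff` of part 5, `Census.length_le_of_card`);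
* `checkAll_box54` — THE CERTIFICATE on the computational window `[200/539, 5/13]` of part 10 (`CornerCertXc`:
  `1/2.695 ≤ x_c ≤ 1/2.6`): 122 856 prefix/suffix classes, 13 641 non-trivial, 8 841 `2 × 2` minors (2 174 identically
  zero, the rest positive by validated dyadic interval arithmetic, scale `2^128`, bisection depth `≤ 6`);
  `native_decide`, ≈ 110 s — COMPUTATIONAL grade twice over (compiled evaluation; the window is the tree's
  `native_decide` enclosure of `μ(ℤ²)`).  (On the elementary window `[1/3, 1/2]` the same certificate also passes —
  minimal relative margin `4.2 · 10⁻⁴` at `x = 1/2` — but takes ≈ 370 s of compiled evaluation; not filed.)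
* `cornerBlock_box54`, **`pa_box54`** (every `x` of the window, ALL `≼`-up-closed `A`, `B`:
  `μ(A) μ(B) ≤ μ(univ) μ(A ∩ B)`), **`weight_pa_box54`** — THE CONCLUSION OF `LeftRightFKG` FOR THIS INSTANCE.

Elementary ("folklore") modulo the compiled evaluations.
-/

namespace Summit.CriticalPhenomena.SAWScalingLimit.Theorems.LeftRightFKG.Negative.PAKit

open Literature.Analysis.ValidatedNumerics
open PolyMP (evalR addR mulR smulR posOn)
open PolyCert (realOf minorI)
open Census (censusList census)

/-! ## §10 Instance: the `5 × 4` box `{0..4} × {0..3}`, `(0,0) → (4,3)` (domain of part 3 `BoxDomain`) -/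

section Inst54

open Finset
open Literature.Probability.LatticeModels Literature.Probability.RandomPlanarGeometry
open CornerLoc (cls restrP IsUpOn NextDet PrevDet IsUp IsInst dom μx)
open CornerCert (criticalFugacity_mem_compWindow)
open scoped Classical

/-- The indicator of the lattice sites `{0..4} × {0..3}` of `dom Cwalk 1` (written out as a lambda at each use, to keep
this certificate file definition-free) is the open box `(-1,5) × (-1,4)` of `RectDomain`. [folklore] -/
theorem inV54_iff (x : Site 2) :
    (fun p : ℤ × ℤ => decide (0 ≤ p.1) && decide (p.1 ≤ 4) && decide (0 ≤ p.2) && decide (p.2 ≤ 3)) (toZ2 x) = true ↔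
      x ∈ Rect.box (-1) 5 (-1) 4 := by
  simp only [toZ2_mk, Bool.and_eq_true, decide_eq_true_eq, Rect.box, Set.mem_setOf_eq]
  omega

/-- **The discrete domain of `dom Cwalk 1` is `ℤ²` induced on the `5 × 4` box** (`Rect.dAdj_iff`, the decidable
boundary-walk hypotheses discharged by `decide`). [folklore] -/
theorem dAdj54_iff (x y : Site 2) : (discreteDomainGraph (dom Cwalk 1) 1).Adj x y ↔
    (zdGraph 2).Adj x y ∧
      (fun p : ℤ × ℤ => decide (0 ≤ p.1) && decide (p.1 ≤ 4) && decide (0 ≤ p.2) && decide (p.2 ≤ 3)) (toZ2 x) = true ∧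
      (fun p : ℤ × ℤ => decide (0 ≤ p.1) && decide (p.1 ≤ 4) && decide (0 ≤ p.2) && decide (p.2 ≤ 3)) (toZ2 y) = true := by
  rw [inV54_iff, inV54_iff]
  refine Rect.dAdj_iff (C := Cwalk) (x₀ := -1) (x₁ := 5) (y₀ := -1) (y₁ := 4) (m₀ := 0) (k₀ := 0)
    (by decide) (by decide) (fun i j hi hi' hj hj' hb => ?_) (by decide) (by decide)
  interval_cases i <;> interval_cases j <;> first | decide | (exfalso; omega)

/-- `(Cwalk, (0,0), (4,3), (0,-1), (4,4))` is a crux instance at mesh `1`. [folklore] -/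
theorem isInstance54 : IsInst 1 (bx 0 0) (bx 4 3) (bx 0 (-1)) (bx 4 4) Cwalk :=
  ⟨one_pos, by decide, by decide, adj_bx _ _ _ _ (by decide), adj_bx _ _ _ _ (by decide)⟩

/-- Every chord of the `5 × 4` instance has at most `19` steps. [folklore] -/
theorem length_le54 (γ : SAW.DomainSAW (dom Cwalk 1) 1 (bx 0 0) (bx 4 3)) : γ.length ≤ 19 := by
  refine Census.length_le_of_card
    (inV := (fun p : ℤ × ℤ => decide (0 ≤ p.1) && decide (p.1 ≤ 4) && decide (0 ≤ p.2) && decide (p.2 ≤ 3)))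
    dAdj54_iff (T := (Finset.Icc (0 : ℤ) 4) ×ˢ (Finset.Icc (0 : ℤ) 3)) (fun p hp => ?_) (by decide) (by decide) γ
  simp only [Bool.and_eq_true, decide_eq_true_eq] at hp
  simp only [Finset.mem_product, Finset.mem_Icc]
  omega

/-- **THE CERTIFICATE** of the `5 × 4` instance (compiled evaluation): 976 chords, on the computational window
`[200/539, 5/13] ∋ x_c` of part 10 (`CornerCertXc`). [folklore] -/
theorem checkAll_box54 :
    checkAll ⟨(4, 3), 0, 4, 0, 3, 19, 2 ^ 128, 6, 200 / 539, 5 / 13⟩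
      (codes (fun p : ℤ × ℤ => decide (0 ≤ p.1) && decide (p.1 ≤ 4) && decide (0 ≤ p.2) && decide (p.2 ≤ 3)) 19
        (toZ2 (bx 0 0)) (toZ2 (bx 4 3))) = true := by
  native_decide

/-- The corner blocks of the `5 × 4` crux instance on the window `[200/539, 5/13]`. [folklore] -/
theorem cornerBlock_box54 {x : ℝ} (hlo : ((200 / 539 : ℚ) : ℝ) ≤ x) (hhi : x ≤ ((5 / 13 : ℚ) : ℝ))
    [Fintype (SAW.DomainSAW (dom Cwalk 1) 1 (bx 0 0) (bx 4 3))] :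
    ∀ (k : ℕ) (π : ℕ → Site 2) (m : ℕ) (σ : ℕ → Site 2) (Sa Sb : Set (Site 2))
      (A B : Set (SAW.DomainSAW (dom Cwalk 1) 1 (bx 0 0) (bx 4 3)))
      (s : Finset (SAW.DomainSAW (dom Cwalk 1) 1 (bx 0 0) (bx 4 3))),
      s = univ.filter (· ∈ restrP k π m σ Sa Sb) → IsUpOn (cls k π m σ) A →
      IsUpOn (cls k π m σ) B → NextDet k A → PrevDet m B →
      (∑ γ ∈ s.filter (· ∈ A), x ^ γ.length) * (∑ γ ∈ s.filter (· ∈ B), x ^ γ.length) ≤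
        (∑ γ ∈ s, x ^ γ.length) * ∑ γ ∈ (s.filter (· ∈ A)).filter (· ∈ B), x ^ γ.length :=
  cornerBlock_of_checkAll (Ω := dom Cwalk 1) (g := ⟨(4, 3), 0, 4, 0, 3, 19, 2 ^ 128, 6, 200 / 539, 5 / 13⟩)
    (fun x y => dAdj54_iff x y) rfl (fun γ => length_le54 γ) (by decide)
    (fun p hp => by
      simp only [Bool.and_eq_true, decide_eq_true_eq] at hp
      exact ⟨⟨hp.1.1.1, hp.1.1.2⟩, hp.1.2, hp.2⟩)
    (codes_nodup _ _ _ _) checkAll_box54 (by decide) (by norm_num) (by norm_num) hlo hhi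

/-- **FULL LEFT–RIGHT POSITIVE ASSOCIATION of the `5 × 4` crux instance on `[200/539, 5/13] ∋ x_c`.** [folklore] -/
theorem pa_box54 {x : ℝ} (hlo : ((200 / 539 : ℚ) : ℝ) ≤ x) (hhi : x ≤ ((5 / 13 : ℚ) : ℝ))
    (A B : Set (SAW.DomainSAW (dom Cwalk 1) 1 (bx 0 0) (bx 4 3))) (hA : IsUp A) (hB : IsUp B) :
    μx x (dom Cwalk 1) 1 (bx 0 0) (bx 4 3) A * μx x (dom Cwalk 1) 1 (bx 0 0) (bx 4 3) B ≤
      μx x (dom Cwalk 1) 1 (bx 0 0) (bx 4 3) Set.univ * μx x (dom Cwalk 1) 1 (bx 0 0) (bx 4 3) (A ∩ B) := by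
  haveI := CornerLoc.finite_domainSAW (a := bx 0 0) (b := bx 4 3) Cwalk one_pos
  haveI : Fintype (SAW.DomainSAW (dom Cwalk 1) 1 (bx 0 0) (bx 4 3)) := Fintype.ofFinite _
  have hx : 0 < x := lt_of_lt_of_le (by norm_num) hlo
  exact CornerLoc.pa_inst_of_cornerBlock hx isInstance54 (cornerBlock_box54 hlo hhi) A B hA hB

/-- **The conclusion of `LeftRightFKG` for the `5 × 4` instance** (`δ = 1`, `C = Cwalk`, `a = (0,0)`, `b = (4,3)`,
`a' = (0,-1)`, `b' = (4,4)`), for ALL `≼`-up-closed `A`, `B`. [folklore] -/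
theorem weight_pa_box54 (A B : Set (SAW.DomainSAW (dom Cwalk 1) 1 (bx 0 0) (bx 4 3))) (hA : IsUp A)
    (hB : IsUp B) :
    SAW.weight (dom Cwalk 1) 1 (bx 0 0) (bx 4 3) A * SAW.weight (dom Cwalk 1) 1 (bx 0 0) (bx 4 3) B ≤
      SAW.weight (dom Cwalk 1) 1 (bx 0 0) (bx 4 3) Set.univ *
        SAW.weight (dom Cwalk 1) 1 (bx 0 0) (bx 4 3) (A ∩ B) := by
  haveI := CornerLoc.finite_domainSAW (a := bx 0 0) (b := bx 4 3) Cwalk one_pos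
  haveI : Fintype (SAW.DomainSAW (dom Cwalk 1) 1 (bx 0 0) (bx 4 3)) := Fintype.ofFinite _
  exact CornerLoc.weight_pa_inst_of_cornerBlock isInstance54
    (cornerBlock_box54 criticalFugacity_mem_compWindow.1 criticalFugacity_mem_compWindow.2) A B hA hB

end Inst54

end Summit.CriticalPhenomena.SAWScalingLimit.Theorems.LeftRightFKG.Negative.PAKit
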